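import Mathlib.Analysis.SpecialFunctions.Gamma.Deligne
import Mathlib.Analysis.SpecialFunctions.Gamma.BohrMollerup
import Mathlib.Analysis.Calculus.MeanValue
import Mathlib.Analysis.SpecialFunctions.Complex.LogDeriv
import Mathlib.Analysis.Real.Pi.Bounds
import HarnessLib

/-!
# Analysis helpers for Stark's residue bound: `(log ‖f‖)' = Re f'/f` on the real axis, the mean value
# inequality for `log ‖f‖`, and crude lower bounds for `Γ`, `Γ_ℝ`, `Γ_ℂ` on `[1, 2]`

Topic `Summits/QuantumAdvantage/QuantumAdvantage/Theorems`, helper for the crux `DegreeOnePrimesEscape`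
(stmt-QuantumAdvantage-11543) of route `LinnikCubicClassGroups`; cell B2b-1 (linnik-cubic), PART B (the
residue lower bound R of line `subgroup-orthogonality-escape`, [Stark1974, Lemma 4]). HONEST FRAMING: the
value of this file is a THEOREM — not summit progress.

* `hasDerivAt_log_norm` — for `f` complex-differentiable at a real point `x` with `f(x) ≠ 0`,
  `t ↦ log ‖f(t)‖` has derivative `Re f'(x)/f(x)` at `x`;
* `log_norm_sub_le` — if `f` is entire, non-zero on `[a,b]` and `Re f'/f ≤ M` on `(a,b)`, then
  `log ‖f(b)‖ − log ‖f(a)‖ ≤ M(b − a)`;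
* `half_le_Gamma`, `half_le_Gamma_of_le_one` — `Γ ≥ ½` on `[½, 2]` (log-convexity, `Γ(2) = 1`, `Γ(3) = 2`);
* `norm_Gammaℝ_ge`, `norm_Gammaℂ_ge` — `‖Γ_ℝ(σ)‖ ≥ 1/16` and `‖Γ_ℂ(σ)‖ ≥ ‖Γ_ℂ(1)‖/16` for `1 ≤ σ ≤ 2`.
-/

noncomputable section

open Complex Filter Topology Set

namespace Summit.QuantumAdvantage.QuantumAdvantage.Theorems.DegreeOnePrimesEscape

namespace Residue

/-! ### `(log ‖f‖)'` and the mean value inequality -/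

/-- **`(log ‖f‖)'(x) = Re f'(x)/f(x)`** along the real axis, for `f` complex-differentiable at the real
point `x` with `f(x) ≠ 0`. [folklore] -/
theorem hasDerivAt_log_norm {f : ℂ → ℂ} {x : ℝ} (hf : DifferentiableAt ℂ f x) (hx : f x ≠ 0) :
    HasDerivAt (fun t : ℝ ↦ Real.log ‖f t‖) ((deriv f x / f x).re) x := by
  have h1 : HasDerivAt (fun t : ℝ ↦ f t) (deriv f x) x := hf.hasDerivAt.comp_ofReal
  have hre : HasDerivAt (fun t : ℝ ↦ (f t).re) (deriv f x).re x :=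
    Complex.reCLM.hasFDerivAt.comp_hasDerivAt x h1
  have him : HasDerivAt (fun t : ℝ ↦ (f t).im) (deriv f x).im x :=
    Complex.imCLM.hasFDerivAt.comp_hasDerivAt x h1
  have hns : HasDerivAt (fun t : ℝ ↦ Complex.normSq (f t))
      ((deriv f x).re * (f x).re + (f x).re * (deriv f x).re +
        ((deriv f x).im * (f x).im + (f x).im * (deriv f x).im)) x := by
    have h := (hre.mul hre).add (him.mul him)
    have e : (fun t : ℝ ↦ Complex.normSq (f t)) =
        fun t : ℝ ↦ (f t).re * (f t).re + (f t).im * (f t).im := by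
      funext t; rw [Complex.normSq_apply]
    rw [e]
    exact h
  have hpos : 0 < Complex.normSq (f x) := Complex.normSq_pos.mpr hx
  have hlog := (hns.log hpos.ne').const_mul (1 / 2)
  have e2 : (fun t : ℝ ↦ Real.log ‖f t‖) = fun t : ℝ ↦ 1 / 2 * Real.log (Complex.normSq (f t)) := by
    funext t
    rw [Complex.normSq_eq_norm_sq, Real.log_pow]
    push_cast
    ring
  rw [e2]
  refine hlog.congr_deriv ?_
  rw [Complex.div_re]
  field_simp
  ring

/-- **Mean value inequality for `log ‖f‖` on a real segment**: if `f` is entire, non-zero on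
`[a, b]`, and `Re f'/f ≤ M` on `(a, b)`, then `log ‖f(b)‖ − log ‖f(a)‖ ≤ M (b − a)`. [folklore] -/
theorem log_norm_sub_le {f : ℂ → ℂ} (hf : Differentiable ℂ f) {a b M : ℝ} (hab : a ≤ b)
    (hne : ∀ t : ℝ, a ≤ t → t ≤ b → f t ≠ 0)
    (hM : ∀ t : ℝ, a < t → t < b → (deriv f t / f t).re ≤ M) :
    Real.log ‖f b‖ - Real.log ‖f a‖ ≤ M * (b - a) := by
  set g : ℝ → ℝ := fun t ↦ Real.log ‖f t‖ with hg
  have hcont : ContinuousOn g (Icc a b) := by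
    refine ContinuousOn.log ?_ fun t ht ↦ (norm_ne_zero_iff.mpr (hne t ht.1 ht.2))
    exact ((hf.continuous.comp Complex.continuous_ofReal).norm).continuousOn
  have hderiv : ∀ t ∈ Ioo a b, HasDerivAt g ((deriv f t / f t).re) t := fun t ht ↦
    hasDerivAt_log_norm (hf t) (hne t ht.1.le ht.2.le)
  have hdiff : DifferentiableOn ℝ g (interior (Icc a b)) := by
    rw [interior_Icc]
    exact fun t ht ↦ (hderiv t ht).differentiableAt.differentiableWithinAt
  have hle : ∀ t ∈ interior (Icc a b), deriv g t ≤ M := by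
    rw [interior_Icc]
    intro t ht
    rw [(hderiv t ht).deriv]
    exact hM t ht.1 ht.2
  have h := (convex_Icc a b).image_sub_le_mul_sub_of_deriv_le hcont hdiff hle a
    (left_mem_Icc.mpr hab) b (right_mem_Icc.mpr hab) hab
  simpa [hg] using h

/-! ### Crude lower bounds for the Gamma factors on `[1, 2]` -/

/-- `Γ(x) ≥ ½` for `1 ≤ x ≤ 2` (log-convexity of `Γ` between `x` and `3`, where `Γ(2) = 1`, `Γ(3) = 2`).
[folklore] -/
theorem half_le_Gamma {x : ℝ} (h1 : 1 ≤ x) (h2 : x ≤ 2) : 1 / 2 ≤ Real.Gamma x := by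
  have hconv := Real.convexOn_log_Gamma
  set t : ℝ := 1 / (3 - x) with ht
  have h3x : 0 < 3 - x := by linarith
  have ht0 : 0 ≤ t := by rw [ht]; positivity
  have ht1 : t ≤ 1 := by rw [ht, div_le_one h3x]; linarith
  have htx : t * (3 - x) = 1 := by rw [ht]; field_simp
  have hcomb : t • x + (1 - t) • (3 : ℝ) = 2 := by
    simp only [smul_eq_mul]
    nlinarith
  have h := hconv.2 (show (0 : ℝ) < x by linarith) (show (0 : ℝ) < 3 by norm_num) ht0
    (by linarith : 0 ≤ 1 - t) (by ring)
  rw [hcomb] at h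
  simp only [Function.comp_apply, Real.Gamma_two, Real.log_one, smul_eq_mul] at h
  have hG3 : Real.Gamma 3 = 2 := by
    rw [show (3 : ℝ) = (2 : ℕ) + 1 by norm_num, Real.Gamma_nat_eq_factorial]
    norm_num [Nat.factorial]
  rw [hG3] at h
  -- `0 ≤ t log Γ(x) + (1 − t) log 2`, and `(1 − t) ≤ t` gives `log Γ(x) ≥ −log 2`
  have hGpos : 0 < Real.Gamma x := Real.Gamma_pos_of_pos (by linarith)
  have htpos : 0 < t := by rw [ht]; positivity
  have hlog2 : 0 < Real.log 2 := Real.log_pos (by norm_num)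
  have h1t : 1 - t ≤ t := by
    -- `t = 1/(3−x) ≥ 1/2`
    have : 1 / 2 ≤ t := by rw [ht, div_le_div_iff₀ (by norm_num) h3x]; linarith
    linarith
  have hkey : -Real.log 2 ≤ Real.log (Real.Gamma x) := by
    by_contra hcon
    rw [not_le] at hcon
    have : t * Real.log (Real.Gamma x) + (1 - t) * Real.log 2 < 0 := by nlinarith
    linarith
  have := Real.exp_le_exp.mpr hkey
  rw [Real.exp_log hGpos, Real.exp_neg, Real.exp_log (by norm_num)] at this
  simpa using this

/-- `Γ(x) ≥ ½` for `½ ≤ x ≤ 1` (`Γ(x) = Γ(x+1)/x ≥ Γ(x+1)`). [folklore] -/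
theorem half_le_Gamma_of_le_one {x : ℝ} (h1 : 1 / 2 ≤ x) (h2 : x ≤ 1) : 1 / 2 ≤ Real.Gamma x := by
  have hx0 : 0 < x := by linarith
  have h := half_le_Gamma (show (1 : ℝ) ≤ x + 1 by linarith) (by linarith)
  rw [Real.Gamma_add_one hx0.ne'] at h
  have hG : 0 < Real.Gamma x := Real.Gamma_pos_of_pos hx0
  nlinarith

/-- `‖Γ_ℝ(σ)‖ ≥ 1/16` for real `1 ≤ σ ≤ 2` (`π^{−σ/2} ≥ 1/π ≥ 1/4`, `Γ(σ/2) ≥ ½`). [folklore] -/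
theorem norm_Gammaℝ_ge {σ : ℝ} (h1 : 1 ≤ σ) (h2 : σ ≤ 2) : 1 / 16 ≤ ‖Gammaℝ (σ : ℂ)‖ := by
  rw [Gammaℝ_def, norm_mul]
  have hpi : ‖(Real.pi : ℂ) ^ (-(σ : ℂ) / 2)‖ = Real.pi ^ (-σ / 2) := by
    rw [Complex.norm_cpow_eq_rpow_re_of_pos Real.pi_pos]
    congr 1
    simp
  have hG : ‖Complex.Gamma ((σ : ℂ) / 2)‖ = Real.Gamma (σ / 2) := by
    rw [show (σ : ℂ) / 2 = ((σ / 2 : ℝ) : ℂ) by push_cast; ring, Complex.Gamma_ofReal, Complex.norm_real,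
      Real.norm_of_nonneg (Real.Gamma_pos_of_pos (by linarith)).le]
  rw [hpi, hG]
  have hpi3 : (3 : ℝ) < Real.pi := Real.pi_gt_three
  have hpi4 : Real.pi < 4 := Real.pi_lt_four
  have hpi1 : (1 : ℝ) ≤ Real.pi := by linarith
  have h1' : Real.pi ^ (-1 : ℝ) ≤ Real.pi ^ (-σ / 2) :=
    Real.rpow_le_rpow_of_exponent_le hpi1 (by linarith)
  have h1'' : (1 : ℝ) / 4 ≤ Real.pi ^ (-1 : ℝ) := by
    rw [Real.rpow_neg_one, one_div]
    exact inv_anti₀ Real.pi_pos hpi4.le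
  have h2' : 1 / 2 ≤ Real.Gamma (σ / 2) := half_le_Gamma_of_le_one (by linarith) (by linarith)
  calc (1 : ℝ) / 16 ≤ 1 / 4 * (1 / 2) := by norm_num
    _ ≤ Real.pi ^ (-σ / 2) * Real.Gamma (σ / 2) :=
        mul_le_mul (h1''.trans h1') h2' (by norm_num) (Real.rpow_nonneg Real.pi_pos.le _)

/-- `‖Γ_ℂ(σ)‖ ≥ (1/16)·‖Γ_ℂ(1)‖` for real `1 ≤ σ ≤ 2` (`Γ_ℂ(1) = 1/π`, `(2π)^{−σ} ≥ 1/(4π²)`,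
`Γ(σ) ≥ ½`). [folklore] -/
theorem norm_Gammaℂ_ge {σ : ℝ} (h1 : 1 ≤ σ) (h2 : σ ≤ 2) : 1 / 16 * ‖Gammaℂ (1 : ℂ)‖ ≤ ‖Gammaℂ (σ : ℂ)‖ := by
  rw [Gammaℂ_one, Gammaℂ_def, norm_mul, norm_mul]
  have hpi3 : (3 : ℝ) < Real.pi := Real.pi_gt_three
  have hpi4 : Real.pi < 4 := Real.pi_lt_four
  have h2π : ‖(2 * (Real.pi : ℂ)) ^ (-(σ : ℂ))‖ = (2 * Real.pi) ^ (-σ) := by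
    rw [show (2 * (Real.pi : ℂ)) = ((2 * Real.pi : ℝ) : ℂ) by push_cast; ring,
      Complex.norm_cpow_eq_rpow_re_of_pos (by positivity)]
    simp
  have hG : ‖Complex.Gamma (σ : ℂ)‖ = Real.Gamma σ := by
    rw [Complex.Gamma_ofReal, Complex.norm_real, Real.norm_of_nonneg (Real.Gamma_pos_of_pos (by linarith)).le]
  have hone : ‖(1 / Real.pi : ℂ)‖ = 1 / Real.pi := by
    rw [show (1 / Real.pi : ℂ) = ((1 / Real.pi : ℝ) : ℂ) by push_cast; ring, Complex.norm_real,
      Real.norm_of_nonneg (by positivity)]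
  rw [h2π, hG, hone, Complex.norm_two]
  -- `(2π)^{-σ} ≥ (2π)^{-2} = 1/(4π²)`
  have hb1 : (1 : ℝ) ≤ 2 * Real.pi := by linarith
  have h3 : (2 * Real.pi) ^ (-(2 : ℝ)) ≤ (2 * Real.pi) ^ (-σ) :=
    Real.rpow_le_rpow_of_exponent_le hb1 (by linarith)
  have h4 : (2 * Real.pi) ^ (-(2 : ℝ)) = 1 / (4 * Real.pi ^ 2) := by
    rw [Real.rpow_neg (by positivity), show (2 : ℝ) = ((2 : ℕ) : ℝ) by norm_num, Real.rpow_natCast]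
    field_simp
    ring
  have h5 : 1 / 2 ≤ Real.Gamma σ := half_le_Gamma h1 h2
  have hpi0 : 0 < Real.pi := Real.pi_pos
  -- `1/16 · 1/π ≤ 2 · 1/(4π²) · 1/2 = 1/(4π²)` iff `4π² ≤ 16π` iff `π ≤ 4`
  calc 1 / 16 * (1 / Real.pi) = 1 / (16 * Real.pi) := by ring
    _ ≤ 1 / (4 * Real.pi ^ 2) := one_div_le_one_div_of_le (by positivity) (by nlinarith)
    _ = 2 * (1 / (4 * Real.pi ^ 2)) * (1 / 2) := by ring
    _ ≤ 2 * (2 * Real.pi) ^ (-σ) * Real.Gamma σ := by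
        rw [← h4]
        exact mul_le_mul (mul_le_mul_of_nonneg_left h3 (by norm_num)) h5 (by norm_num)
          (by positivity)

end Residue

end Summit.QuantumAdvantage.QuantumAdvantage.Theorems.DegreeOnePrimesEscape

end
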